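import Literature.NumberTheory.LFunctions.ZetaZeroDensityExplicit
import Literature.NumberTheory.LFunctions.LehmanCriticalLineBound
import HarnessLib

/-!
# RH-FREE — Hiary–Patel–Yang's explicit van der Corput bound `|ζ(½ + it)| ≤ 0.618 t^{1/6} log t`, its 2026 successor `0.611` (Revers), and the Riemann–Siegel–Lehman bound («nothing here bears on the truth of RH»)

Topic `Literature/NumberTheory/LFunctions` (RH literature-typing tranche 1, L4 "explicit zero
statistics", gen 2: the critical-line INPUT of the explicit zero-density tables of
`ZetaZeroDensityExplicit.lean`, of the explicit `N(T)`/`S(T)` bounds of Hasanalizade–Shen–Wong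
(`ZetaZeroCountExplicit.lean`), of Turing's method (`TuringMethodTrudgianIINumerics.lean`) and of
Yang's "intermediate" zero-free region (`ZetaLittlewoodRegionExplicit.lean`)). Label: **RH-FREE** —
unconditional published theorems vendored as NAMED FACTS (`def … : Prop`, D-0014; nothing is
asserted, users take `(h : …)`), plus cheap PROVED consequences. Nothing here bears on the truth
of RH.

Source: G. A. Hiary, D. Patel, A. Yang, *An improved explicit estimate for `ζ(1/2 + it)`*,
J. Number Theory **256** (2024) 195–217 (arXiv:2207.02366v1; the statements below are read at
`[corpus:paper:arxiv-2207.02366 p0002 (Thm. 1.1, Lemmas 2.1–2.2)]`):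

* `zeta_half_line_hiary_patel_yang` — **Theorem 1.1**: "For `t ≥ 3`, we have
  `|ζ(1/2 + it)| ≤ 0.618 t^{1/6} log t`." The record explicit Weyl-strength bound; it supersedes
  Hiary 2016 (`0.63`, whose proof used the Cheng–Graham form of the Kusmin–Landau lemma with the
  constant `1/π` instead of the sharp `2/π`; with the correction Hiary's constant becomes `0.77`,
  source §1) and it is the input `a₁ = 0.618` of Fiori–Kadiri–Swidinsky's second tables
  (`FioriKadiriSwidinsky2023_table5_hpy`, `…_table6_hpy`) and of Yang's region
  `zero_free_region_ford_hpy`.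
* `zeta_half_line_riemann_siegel_lehman` — **Lemma 2.2** ("Riemann–Siegel–Lehman bound"): "If
  `t ≥ 200`, then `|ζ(1/2 + it)| ≤ 4 t^{1/4}/(2π)^{1/4} − 2.08`" (from the Riemann–Siegel formula
  with Gabcke's remainder, Lemma 2.1; = Hiary 2016, Lemma 2.3).
* `zeta_half_line_revers` (gen-3 addition) — **Revers 2026, Theorem 1.1** (arXiv:2602.05614v1,
  PREPRINT, unrefereed; `[corpus:paper:arxiv-2602.05614 p0003–p0004 (Thm. 1.1)]`): "(a) For `t ≥ 3`
  we have `|ζ(1/2+it)| ≤ 0.611 t^{1/6} log t`. (b) For `t ≥ 8.97·10¹⁷` we have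
  `|ζ(1/2+it)| ≤ 0.566 t^{1/6} log t`." — the announced successor of Theorem 1.1 above (a refined
  explicit van der Corput method plus a computation in the intermediate range); PROVED here:
  `zeta_half_line_revers.hiary_patel_yang` (it implies the `0.618` fact, hence everything downstream).

Tree search first (nothing restated): the tree held the `0.618` bound only as an INLINE hypothesis
— `hHPY : ∀ t ≥ 3, ‖ζ(½+it)‖ ≤ 0.618 t^{1/6} log t` in
`Literature.NumberTheory.LFunctions.trudgianII_H1_of_HPY`,
`Literature.NumberTheory.LFunctions.abs_integral_zetaArgS_le_trudgianII_of_HPY_TZ`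
(`TuringMethodTrudgianIINumerics{,Check}.lean`) and as the antecedent of
`FioriKadiriSwidinsky2023_table5_hpy/_table6_hpy` — written in exactly the shape typed here, so
`(h : zeta_half_line_hiary_patel_yang)` feeds all of them verbatim; the other critical-line facts of
the tree are different statements: `zeta_half_line_patel` (sub-Weyl `307.098 |t|^{27/164}`),
`Trudgian2011_lemma_2_5(_allT)` (`2.53 t^{1/4}`), `hiary2016_corollary1` (hybrid, `q`-aspect),
and the qualitative `norm_riemannZeta_half_le_weyl` (`∃ C t₀`, PROVED).

## Proved here (no new hypotheses)

* `zeta_half_line_hiary_patel_yang.abs` — the two-sided form (`|t| ≥ 3`, by `ζ(s̄) = conj ζ(s)`);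
  `.hiary_corrected` (`0.77`), `.hiary_2016` (`0.63`, the input of Kadiri–Lumley–Ng 2018, hence
  their Table 1 stands, cf. `ZetaZeroDensityExplicit.lean`); `.weyl` (the qualitative form).
* `zeta_half_line_hiary_patel_yang.fks_table5b`, `.fks_table6b` — with this fact the CONDITIONAL
  second halves of FKS's Tables 5–6 become unconditional consequences of the two named facts.
* `zeta_half_line_riemann_siegel_lehman.trudgian2011_lemma_2_5` — Lemma 2.2 implies the tree's
  named fact `Trudgian2011_lemma_2_5` (`|ζ(½+it)| ≤ 2.53 t^{1/4}` for `t ≥ 128π`), since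
  `128π > 200` and `4/(2π)^{1/4} = 2.5265… ≤ 2.53`.

Deliberately NOT here: the proof (explicit `A`/`B`/`AB` processes, Lemmas 2.3–2.6, and the
case analysis of §3), the intermediate large-`t` bound
`0.478013 t^{1/6} log t + 3.853165 t^{1/6} − 2.914229` of §3.4, and bounds on other lines
(`σ = 1`: Patel 2022, Hiary–Leong–Yang 2025 — not zero statistics).

## References

* G. A. Hiary, D. Patel, A. Yang, J. Number Theory 256 (2024) 195–217, Thm. 1.1, Lemmas 2.1–2.2.
  [HiaryPatelYang2024]
* G. A. Hiary, *An explicit van der Corput estimate for `ζ(1/2+it)`*, Indag. Math. 27 (2016)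
  524–533, Thm. 1.1, Lemma 2.3. [HiaryIndag2016]
* T. S. Trudgian, Math. Comp. 80 (2011) 2259–2279, Lemma 2.5 (Lehman's `2.53 t^{1/4}`). [Trudgian2011]
* A. Fiori, H. Kadiri, J. Swidinsky, J. Math. Anal. Appl. 527 (2023) 127426, Tables 5–6 (second
  halves, `a₁ = 0.618`). [FioriKadiriSwidinsky2023]
* M. Revers, *A new improved explicit estimate for `ζ(1/2+it)`*, arXiv:2602.05614 (2026), Thm. 1.1
  (preprint). [Revers2026]
-/

noncomputable section

open Complex Real
open scoped ComplexConjugate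

namespace Literature.NumberTheory.LFunctions

/-! ## The named facts -/

/-- NAMED FACT (**Hiary–Patel–Yang 2024, Theorem 1.1**, as printed: "For `t ≥ 3`, we have
`|ζ(1/2 + it)| ≤ 0.618 t^{1/6} log t`."). Unconditional. Typed in the exact shape of the inline
hypotheses `hHPY` already used in the tree (`trudgianII_H1_of_HPY`,
`FioriKadiriSwidinsky2023_table5_hpy`), so `h t ht` feeds them verbatim. Users take
`(h : zeta_half_line_hiary_patel_yang)`. [cite: HiaryPatelYang2024, Thm. 1.1] -/
def zeta_half_line_hiary_patel_yang : Prop :=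
  ∀ t : ℝ, 3 ≤ t → ‖riemannZeta (1 / 2 + t * I)‖ ≤ 0.618 * t ^ (1 / 6 : ℝ) * Real.log t

/-- NAMED FACT (**Hiary–Patel–Yang 2024, Lemma 2.2**, "Riemann–Siegel–Lehman bound", as printed:
"If `t ≥ 200`, then `|ζ(1/2 + it)| ≤ 4t^{1/4}/(2π)^{1/4} − 2.08`."; proof: the Riemann–Siegel
formula with Gabcke's remainder `R(t) = 1.48 t^{−1/4} + 0.127 t^{−3/4}` (Lemma 2.1), the main sum
beyond `n = 5` bounded by an integral; = Hiary 2016 (Indag. Math.), Lemma 2.3). Unconditional.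
Users take `(h : zeta_half_line_riemann_siegel_lehman)`.
[cite: HiaryPatelYang2024, Lemma 2.2] [cite: HiaryIndag2016, Lemma 2.3] -/
def zeta_half_line_riemann_siegel_lehman : Prop :=
  ∀ t : ℝ, 200 ≤ t →
    ‖riemannZeta (1 / 2 + t * I)‖ ≤ 4 * t ^ (1 / 4 : ℝ) / (2 * π) ^ (1 / 4 : ℝ) - 2.08

/-- NAMED FACT (**Revers 2026, Theorem 1.1**, arXiv:2602.05614v1 — PREPRINT, unrefereed — as
printed: "(a) For `t ≥ 3` we have `|ζ(1/2+it)| ≤ 0.611 t^{1/6} log t`. (b) For `t ≥ 8.97·10¹⁷` we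
have `|ζ(1/2+it)| ≤ 0.566 t^{1/6} log t`."). Unconditional (an explicit van der Corput method after
Hiary–Patel–Yang, plus a computation in the intermediate `t`-range, source §1). Both clauses, in the
shape of `zeta_half_line_hiary_patel_yang`. Users take `(h : zeta_half_line_revers)`.
[cite: Revers2026, Thm. 1.1] -/
def zeta_half_line_revers : Prop :=
  (∀ t : ℝ, 3 ≤ t → ‖riemannZeta (1 / 2 + t * I)‖ ≤ 0.611 * t ^ (1 / 6 : ℝ) * Real.log t) ∧
    ∀ t : ℝ, 8.97e17 ≤ t → ‖riemannZeta (1 / 2 + t * I)‖ ≤ 0.566 * t ^ (1 / 6 : ℝ) * Real.log t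

/-! ## Consequences of Theorem 1.1 (proved) -/

namespace zeta_half_line_hiary_patel_yang

/-- Two-sided form: for `|t| ≥ 3`, `|ζ(½ + it)| ≤ 0.618 |t|^{1/6} log|t|` (`ζ(s̄) = conj ζ(s)`).
[cite: HiaryPatelYang2024, Thm. 1.1] -/
theorem abs (h : zeta_half_line_hiary_patel_yang) {t : ℝ} (ht : 3 ≤ |t|) :
    ‖riemannZeta (1 / 2 + t * I)‖ ≤ 0.618 * |t| ^ (1 / 6 : ℝ) * Real.log |t| := by
  rcases le_or_gt 0 t with ht0 | ht0
  · rw [abs_of_nonneg ht0] at ht ⊢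
    exact h t ht
  · have hneg : 3 ≤ -t := by rwa [abs_of_neg ht0] at ht
    have hconj : riemannZeta (1 / 2 + t * I) = conj (riemannZeta (1 / 2 + (-t : ℝ) * I)) := by
      rw [← riemannZeta_conj]; congr 1
      apply Complex.ext <;> simp
    rw [hconj, Complex.norm_conj, abs_of_neg ht0]
    exact_mod_cast h (-t) hneg

/-- Any larger constant: for `c ≥ 0.618` and `t ≥ 3`, `|ζ(½+it)| ≤ c t^{1/6} log t`.
[cite: HiaryPatelYang2024, Thm. 1.1] -/
theorem of_le (h : zeta_half_line_hiary_patel_yang) {c : ℝ} (hc : 0.618 ≤ c) {t : ℝ} (ht : 3 ≤ t) :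
    ‖riemannZeta (1 / 2 + t * I)‖ ≤ c * t ^ (1 / 6 : ℝ) * Real.log t := by
  have h0 : 0 ≤ t ^ (1 / 6 : ℝ) * Real.log t :=
    mul_nonneg (Real.rpow_nonneg (by linarith) _) (Real.log_nonneg (by linarith))
  calc ‖riemannZeta (1 / 2 + t * I)‖ ≤ 0.618 * t ^ (1 / 6 : ℝ) * Real.log t := h t ht
    _ = 0.618 * (t ^ (1 / 6 : ℝ) * Real.log t) := by ring
    _ ≤ c * (t ^ (1 / 6 : ℝ) * Real.log t) := by gcongr
    _ = c * t ^ (1 / 6 : ℝ) * Real.log t := by ring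

/-- **Hiary's corrected bound** (`0.77`, source §1: "the revised bound becomes
`|ζ(1/2 + it)| ≤ 0.77 t^{1/6} log t` for `t ≥ 3`"; the `a₁ = 0.77` input of Fiori–Kadiri–Swidinsky
2023 and Johnston–Yang 2023, and Hasanalizade–Shen–Wong's Theorem 1.3 input) follows.
[cite: HiaryPatelYang2024, §1 and Thm. 1.1] -/
theorem hiary_corrected (h : zeta_half_line_hiary_patel_yang) {t : ℝ} (ht : 3 ≤ t) :
    ‖riemannZeta (1 / 2 + t * I)‖ ≤ 0.77 * t ^ (1 / 6 : ℝ) * Real.log t :=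
  h.of_le (by norm_num) ht

/-- **Hiary's 2016 inequality** `|ζ(½+it)| ≤ 0.63 t^{1/6} log t` (`t ≥ 3`) — whose 2016 proof was
flawed (source §1) but which is the input of Kadiri–Lumley–Ng 2018's Table 1 — holds, a fortiori.
[cite: HiaryPatelYang2024, Thm. 1.1] [cite: HiaryIndag2016, Thm. 1.1] -/
theorem hiary_2016 (h : zeta_half_line_hiary_patel_yang) {t : ℝ} (ht : 3 ≤ t) :
    ‖riemannZeta (1 / 2 + t * I)‖ ≤ 0.63 * t ^ (1 / 6 : ℝ) * Real.log t :=
  h.of_le (by norm_num) ht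

/-- The qualitative Weyl bound in the shape of the tree's (proved)
`norm_riemannZeta_half_le_weyl`: `∃ C t₀, ∀ t ≥ t₀, |ζ(½+it)| ≤ C t^{1/6} log t`.
[cite: HiaryPatelYang2024, Thm. 1.1] -/
theorem weyl (h : zeta_half_line_hiary_patel_yang) :
    ∃ C t₀ : ℝ, ∀ t : ℝ, t₀ ≤ t → ‖riemannZeta (1 / 2 + t * I)‖ ≤ C * t ^ (1 / 6 : ℝ) * Real.log t :=
  ⟨0.618, 3, fun t ht => h t ht⟩

/-- **FKS Table 5, second half, unconditionally** (modulo the two named facts): Hiary–Patel–Yang's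
theorem discharges the printed antecedent "`a₁ = 0.618`" of `FioriKadiriSwidinsky2023_table5_hpy`:
for every row `(σ, c₁, c₂) ∈ FKS2023.table5b` and `T ≥ 3·10¹²`,
`N(σ, T) ≤ c₁ T^{(8/3)(1−σ)} (log T)^{5−2σ} + c₂ (log T)²`.
[cite: FioriKadiriSwidinsky2023, Thm. 2.7 and Table 5 (a₁ = 0.618)] [cite: HiaryPatelYang2024, Thm. 1.1] -/
theorem fks_table5b (h : zeta_half_line_hiary_patel_yang) (hF : FioriKadiriSwidinsky2023_table5_hpy)
    {σ c₁ c₂ : ℝ} (hrow : (σ, c₁, c₂) ∈ FKS2023.table5b) {T : ℝ} (hT : FKS2023.H₀ ≤ T) :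
    (zetaZeroCountRe σ T : ℝ) ≤ inghamBound c₁ c₂ σ T :=
  hF h σ c₁ c₂ hrow T hT

/-- **FKS Table 6, second half, unconditionally** (modulo the two named facts): for every row
`(σ₁, σ₂, c̃₁, c̃₂) ∈ FKS2023.table6b`, `σ ∈ [σ₁, σ₂]`, `T ≥ 3·10¹²`:
`N(σ, T) ≤ c̃₁ T^{(8/3)(1−σ)} (log T)^{5−2σ} + c̃₂ (log T)²`.
[cite: FioriKadiriSwidinsky2023, Cor. 2.9 and Table 6 (a₁ = 0.618)] [cite: HiaryPatelYang2024, Thm. 1.1] -/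
theorem fks_table6b (h : zeta_half_line_hiary_patel_yang) (hF : FioriKadiriSwidinsky2023_table6_hpy)
    {σ₁ σ₂ c₁ c₂ : ℝ} (hrow : (σ₁, σ₂, c₁, c₂) ∈ FKS2023.table6b) {σ T : ℝ} (h₁ : σ₁ ≤ σ)
    (h₂ : σ ≤ σ₂) (hT : FKS2023.H₀ ≤ T) :
    (zetaZeroCountRe σ T : ℝ) ≤ inghamBound c₁ c₂ σ T :=
  hF h σ₁ σ₂ c₁ c₂ hrow σ T h₁ h₂ hT

/-- The displayed example of FKS's second Table 5 at `σ = 0.9` (row `(0.900, 10.8209, 2.8604)`):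
`N(0.9, T) ≤ 10.8209 T^{4/15} (log T)^{16/5} + 2.8604 (log T)²` for `T ≥ 3·10¹²`, now from the two
named facts. [cite: FioriKadiriSwidinsky2023, Table 5 (a₁ = 0.618), row σ = 0.900] -/
theorem fks_table5b_row_090 (h : zeta_half_line_hiary_patel_yang)
    (hF : FioriKadiriSwidinsky2023_table5_hpy) {T : ℝ} (hT : FKS2023.H₀ ≤ T) :
    (zetaZeroCountRe 0.9 T : ℝ) ≤
      10.8209 * T ^ (4 / 15 : ℝ) * Real.log T ^ (16 / 5 : ℝ) + 2.8604 * Real.log T ^ 2 := by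
  have hrow : ((0.900 : ℝ), (10.8209 : ℝ), (2.8604 : ℝ)) ∈ FKS2023.table5b := by
    simp [FKS2023.table5b]
  have h1 := h.fks_table5b hF hrow hT
  rw [inghamBound] at h1
  have e1 : (8 / 3 * (1 - 0.900) : ℝ) = 4 / 15 := by norm_num
  have e2 : (5 - 2 * 0.900 : ℝ) = 16 / 5 := by norm_num
  rw [e1, e2] at h1
  norm_num at h1 ⊢
  exact h1

end zeta_half_line_hiary_patel_yang

/-! ## Consequences of Revers's Theorem 1.1 (proved) -/

namespace zeta_half_line_revers

/-- **Revers 2026 ⟹ Hiary–Patel–Yang 2024**: `0.611 ≤ 0.618`, so clause (a) implies the tree's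
`zeta_half_line_hiary_patel_yang` (and with it every consequence above and downstream).
[cite: Revers2026, Thm. 1.1 (a)] [cite: HiaryPatelYang2024, Thm. 1.1] -/
theorem hiary_patel_yang (h : zeta_half_line_revers) : zeta_half_line_hiary_patel_yang := by
  intro t ht
  have h0 : 0 ≤ t ^ (1 / 6 : ℝ) * Real.log t :=
    mul_nonneg (Real.rpow_nonneg (by linarith) _) (Real.log_nonneg (by linarith))
  calc ‖riemannZeta (1 / 2 + t * I)‖ ≤ 0.611 * t ^ (1 / 6 : ℝ) * Real.log t := h.1 t ht
    _ = 0.611 * (t ^ (1 / 6 : ℝ) * Real.log t) := by ring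
    _ ≤ 0.618 * (t ^ (1 / 6 : ℝ) * Real.log t) := by gcongr; norm_num
    _ = 0.618 * t ^ (1 / 6 : ℝ) * Real.log t := by ring

/-- Two-sided form of clause (a): for `|t| ≥ 3`, `|ζ(½ + it)| ≤ 0.611 |t|^{1/6} log|t|`.
[cite: Revers2026, Thm. 1.1 (a)] -/
theorem abs (h : zeta_half_line_revers) {t : ℝ} (ht : 3 ≤ |t|) :
    ‖riemannZeta (1 / 2 + t * I)‖ ≤ 0.611 * |t| ^ (1 / 6 : ℝ) * Real.log |t| := by
  rcases le_or_gt 0 t with ht0 | ht0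
  · rw [abs_of_nonneg ht0] at ht ⊢
    exact h.1 t ht
  · have hneg : 3 ≤ -t := by rwa [abs_of_neg ht0] at ht
    have hconj : riemannZeta (1 / 2 + t * I) = conj (riemannZeta (1 / 2 + (-t : ℝ) * I)) := by
      rw [← riemannZeta_conj]; congr 1
      apply Complex.ext <;> simp
    rw [hconj, Complex.norm_conj, abs_of_neg ht0]
    exact_mod_cast h.1 (-t) hneg

/-- The large-`t` clause (b) alone: for `t ≥ 8.97·10¹⁷`, `|ζ(½+it)| ≤ 0.566 t^{1/6} log t`.
[cite: Revers2026, Thm. 1.1 (b)] -/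
theorem large (h : zeta_half_line_revers) {t : ℝ} (ht : 8.97e17 ≤ t) :
    ‖riemannZeta (1 / 2 + t * I)‖ ≤ 0.566 * t ^ (1 / 6 : ℝ) * Real.log t :=
  h.2 t ht

end zeta_half_line_revers

/-! ## Consequence of Lemma 2.2 (proved) -/

namespace zeta_half_line_riemann_siegel_lehman

/-- `(2π)^{1/4} ≥ 1.5811` (since `1.5811⁴ = 6.2493… ≤ 2π`). [folklore] -/
private theorem two_pi_rpow_quarter_ge : (1.5811 : ℝ) ≤ (2 * π) ^ (1 / 4 : ℝ) := by
  have hπ : (1.5811 : ℝ) ^ 4 ≤ 2 * π := by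
    have := Real.pi_gt_d2
    nlinarith
  have e : (1.5811 : ℝ) = ((1.5811 : ℝ) ^ 4) ^ ((4 : ℕ)⁻¹ : ℝ) :=
    (Real.pow_rpow_inv_natCast (by norm_num) (by norm_num)).symm
  rw [e, show ((4 : ℕ)⁻¹ : ℝ) = 1 / 4 by norm_num]
  exact Real.rpow_le_rpow (by positivity) hπ (by norm_num)

/-- **Lemma 2.2 implies Trudgian 2011, Lemma 2.5** (the tree's named fact
`Trudgian2011_lemma_2_5`: `|ζ(½+it)| ≤ 2.53 t^{1/4}` for `t ≥ 128π`): indeed `128π ≥ 200`, and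
`4 t^{1/4}/(2π)^{1/4} − 2.08 ≤ (4/1.5811) t^{1/4} ≤ 2.53 t^{1/4}`.
[cite: HiaryPatelYang2024, Lemma 2.2] [cite: Trudgian2011, Lemma 2.5] -/
theorem trudgian2011_lemma_2_5 (h : zeta_half_line_riemann_siegel_lehman) : Trudgian2011_lemma_2_5 := by
  intro t ht
  have hπ := Real.pi_gt_three
  have ht200 : (200 : ℝ) ≤ t := by nlinarith
  have h1 := h t ht200
  have hq := two_pi_rpow_quarter_ge
  have hqpos : (0 : ℝ) < (2 * π) ^ (1 / 4 : ℝ) := by linarith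
  have htq : 0 ≤ t ^ (1 / 4 : ℝ) := Real.rpow_nonneg (by linarith) _
  have h2 : 4 * t ^ (1 / 4 : ℝ) / (2 * π) ^ (1 / 4 : ℝ) ≤ 2.53 * t ^ (1 / 4 : ℝ) := by
    rw [div_le_iff₀ hqpos]
    nlinarith
  linarith

end zeta_half_line_riemann_siegel_lehman

end Literature.NumberTheory.LFunctions

end
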